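import Summits.CriticalPhenomena.CardyFormulaZ2.Theorems.CardyBoundaryCoulombGasHalfPlaneMarkDensityLawIdentification
import Summits.CriticalPhenomena.CardyFormulaZ2.Theorems.CardyBoundaryCoulombGasHalfPlaneMarkDensityLawSymmetry

/-!
# Line `Sketch`, open stub C⁺ — a priori structure of the collinear half-plane crossing function, VII:
# the Möbius reduction (crux stmt-CriticalPhenomena-5661, lead c2-0)

Pure real algebra first (§14): a function `G` of four ordered collinear marks that is invariant
under translations, dilations, the reflection `x ↦ −x` (with the marks reversed) and the inversion
`x ↦ −1/x` on positive quadruples is a function of the cross-ratio alone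
(`eq_of_crossRatio_eq`): normalise affinely to `(0, β, γ, 1)`, and move inside that normal form
with the one-parameter group `g_λ(x) = λx/((λ−1)x+1)` fixing `0, 1`, which is a translate–dilate–
invert–translate word (`moebius01`).

Then (§15) the sharpest honest decomposition of the crux this seat can certify: since a full limit
of `P_n` is automatically translation invariant (`translate_of_jointLimit`), dilation invariant
(`dilate_of_limit`) and reflection symmetric (`reflect_of_jointLimit`),
**C⁺ ⟺ (the full limit `G` exists) ∧ (G is inversion covariant on positive quadruples) ∧
(G has Cardy's profile along the single normal family `(0, t, 1, 2)`, `η = t/(2−t)`)**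
(`collinearCardy_iff_limit_inversion_profile`, and for the crux by name
`halfPlaneMarkDensityLaw_iff_limit_inversion_profile`).  EXISTENCE, INVERSION COVARIANCE (the
conformal content beyond the lattice symmetries) and the PROFILE `F` are the three open inputs.
-/

noncomputable section

namespace Summit.CriticalPhenomena.CardyFormulaZ2.Cruxes.HalfPlaneMarkDensityLaw.SketchLine

open Literature.Probability.Percolation Literature.Probability.LatticeModels
open Literature.Probability.RandomPlanarGeometry (crossRatio)
open MeasureTheory Filter Set
open scoped Topology
open Summit.CriticalPhenomena.CardyFormulaZ2.Theses.CardyBoundaryCoulombGas (HalfPlaneMarkDensityLaw)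
open Summit.CriticalPhenomena.CardyFormulaZ2.Theorems.HalfPlaneMarkDensityLaw.Negative

namespace Subseq

/-! ## §14 Functions of four ordered marks invariant under the real Möbius moves -/

section Algebra

variable {G : ℝ → ℝ → ℝ → ℝ → ℝ}
  (hT : ∀ a b c y t : ℝ, a < b → b < c → c < y → G (a + t) (b + t) (c + t) (y + t) = G a b c y)
  (hD : ∀ a b c y s : ℝ, a < b → b < c → c < y → 0 < s → G (s * a) (s * b) (s * c) (s * y) = G a b c y)
  (hR : ∀ a b c y : ℝ, a < b → b < c → c < y → G (-y) (-c) (-b) (-a) = G a b c y)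
  (hI : ∀ a b c y : ℝ, 0 < a → a < b → b < c → c < y →
    G (-1 / a) (-1 / b) (-1 / c) (-1 / y) = G a b c y)

/-- `x ↦ −1/x` is increasing on the positive half-line. [folklore] -/
theorem neg_one_div_lt_of_pos {u v : ℝ} (hu : 0 < u) (huv : u < v) : -1 / u < -1 / v := by
  rw [neg_div, neg_div, neg_lt_neg_iff]; exact one_div_lt_one_div_of_lt hu huv

/-- `x ↦ −1/x` is increasing on the negative half-line. [folklore] -/
theorem neg_one_div_lt_of_neg {u v : ℝ} (hv : v < 0) (huv : u < v) : -1 / u < -1 / v := by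
  rw [neg_div, neg_div, neg_lt_neg_iff]; exact (one_div_lt_one_div_of_neg hv (huv.trans hv)).2 huv

/-- The denominators of `g_λ` are positive on `[0,1]` for `λ > 0`. [folklore] -/
theorem den_pos {l x : ℝ} (hl : 0 < l) (hx0 : 0 ≤ x) (hx1 : x ≤ 1) : 0 < (l - 1) * x + 1 := by
  rcases le_or_gt 1 l with h | h
  · nlinarith [mul_nonneg (sub_nonneg.2 h) hx0]
  · nlinarith [mul_le_mul_of_nonpos_left hx1 (sub_nonpos.2 h.le)]

include hR hI in
/-- Inversion covariance on NEGATIVE quadruples follows from the positive case and the reflection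
(`I₋ = R ∘ I₊ ∘ R`). [folklore] -/
theorem inv_neg (a b c y : ℝ) (hab : a < b) (hbc : b < c) (hcy : c < y) (hy : y < 0) :
    G (-1 / a) (-1 / b) (-1 / c) (-1 / y) = G a b c y := by
  have h1 := hR a b c y hab hbc hcy
  have h2 := hI (-y) (-c) (-b) (-a) (by linarith) (by linarith) (by linarith) (by linarith)
  have h3 := hR (1 / y) (1 / c) (1 / b) (1 / a)
    ((one_div_lt_one_div_of_neg hy (by linarith)).2 hcy)
    ((one_div_lt_one_div_of_neg (by linarith) (by linarith)).2 hbc)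
    ((one_div_lt_one_div_of_neg (by linarith) (by linarith)).2 hab)
  have e : ∀ x : ℝ, -1 / -x = 1 / x := fun x ↦ by rw [neg_div_neg_eq]
  simp only [e] at h2
  have e' : ∀ x : ℝ, -(1 / x) = -1 / x := fun x ↦ by rw [neg_div]
  simp only [e'] at h3
  rw [h3, h2, h1]

include hT hR hI in
/-- Inversion covariance about any centre outside the marks: if all four marks lie on one side of
`−s`, then `G(−1/(a+s), …, −1/(y+s)) = G(a,b,c,y)`. [folklore] -/
theorem inv_shift (a b c y s : ℝ) (hab : a < b) (hbc : b < c) (hcy : c < y)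
    (hs : 0 < a + s ∨ y + s < 0) :
    G (-1 / (a + s)) (-1 / (b + s)) (-1 / (c + s)) (-1 / (y + s)) = G a b c y := by
  rw [← hT a b c y s hab hbc hcy]
  rcases hs with hs | hs
  · exact hI _ _ _ _ hs (by linarith) (by linarith) (by linarith)
  · exact inv_neg hR hI _ _ _ _ (by linarith) (by linarith) (by linarith) hs

/-- The translate–dilate–invert–translate word for `g_λ(x) = λx/((λ−1)x+1)`, `λ ≠ 1`:
`λ/(λ−1)² · (−1/(x + 1/(λ−1))) + λ/(λ−1) = g_λ(x)` whenever `(λ−1)x + 1 ≠ 0`. [folklore] -/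
theorem gl_word {l x : ℝ} (hl1 : l ≠ 1) (hx : (l - 1) * x + 1 ≠ 0) :
    l / (l - 1) ^ 2 * (-1 / (x + 1 / (l - 1))) + l / (l - 1) = l * x / ((l - 1) * x + 1) := by
  have hm : l - 1 ≠ 0 := sub_ne_zero.2 hl1
  have e1 : x + 1 / (l - 1) = ((l - 1) * x + 1) / (l - 1) := by
    rw [eq_div_iff hm]; field_simp
  rw [e1, div_div_eq_mul_div]
  simp only [div_eq_mul_inv, ← inv_pow]
  set u := (l - 1)⁻¹ with hu
  set v := ((l - 1) * x + 1)⁻¹ with hv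
  have hu' : (l - 1) * u = 1 := mul_inv_cancel₀ hm
  have hv' : ((l - 1) * x + 1) * v = 1 := mul_inv_cancel₀ hx
  linear_combination (l * v * (x - u)) * hu' + (-l * u) * hv'

include hT hD hR hI in
/-- **Moving inside the normal form.** For `0 < β < γ < 1` and `λ > 0`,
`G(0, β, γ, 1) = G(0, g_λ β, g_λ γ, 1)` with `g_λ(x) = λx/((λ−1)x+1)`. [folklore] -/
theorem moebius01 {β γ l : ℝ} (hβ : 0 < β) (hβγ : β < γ) (hγ : γ < 1) (hl : 0 < l) :
    G 0 β γ 1 = G 0 (l * β / ((l - 1) * β + 1)) (l * γ / ((l - 1) * γ + 1)) 1 := by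
  rcases eq_or_ne l 1 with rfl | hl1
  · simp
  set m := l - 1 with hm
  have hm0 : m ≠ 0 := sub_ne_zero.2 hl1
  -- the inverted quadruple
  set s := 1 / m with hs
  have hside : 0 < 0 + s ∨ 1 + s < 0 := by
    rcases lt_or_gt_of_ne hm0 with hneg | hpos
    · right
      have hm1 : -1 < m := by rw [hm]; linarith
      have : s < -1 := by
        rw [hs, div_lt_iff_of_neg hneg]; nlinarith
      linarith
    · left; rw [hs]; positivity
  have h1 := inv_shift hT hR hI 0 β γ 1 s hβ hβγ hγ hside
  -- order of the inverted quadruple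
  have hord : -1 / (0 + s) < -1 / (β + s) ∧ -1 / (β + s) < -1 / (γ + s) ∧
      -1 / (γ + s) < -1 / (1 + s) := by
    rcases hside with hpos | hneg
    · exact ⟨neg_one_div_lt_of_pos hpos (by linarith), neg_one_div_lt_of_pos (by linarith) (by linarith),
        neg_one_div_lt_of_pos (by linarith) (by linarith)⟩
    · exact ⟨neg_one_div_lt_of_neg (by linarith) (by linarith),
        neg_one_div_lt_of_neg (by linarith) (by linarith), neg_one_div_lt_of_neg hneg (by linarith)⟩
  -- dilate by λ/μ² and translate by λ/μ
  have hscale : 0 < l / m ^ 2 := by positivity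
  have h2 := hD _ _ _ _ (l / m ^ 2) hord.1 hord.2.1 hord.2.2 hscale
  have h3 := hT _ _ _ _ (l / m) (mul_lt_mul_of_pos_left hord.1 hscale)
    (mul_lt_mul_of_pos_left hord.2.1 hscale) (mul_lt_mul_of_pos_left hord.2.2 hscale)
  rw [← h1, ← h2, ← h3]
  have e0 : l / m ^ 2 * (-1 / (0 + s)) + l / m = 0 := by rw [hs]; field_simp; ring
  have e1 : l / m ^ 2 * (-1 / (1 + s)) + l / m = 1 := by
    rw [hs, hm, gl_word hl1 (den_pos hl zero_le_one le_rfl).ne', mul_one, mul_one, sub_add_cancel,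
      div_self hl.ne']
  have eβ : l / m ^ 2 * (-1 / (β + s)) + l / m = l * β / ((l - 1) * β + 1) := by
    rw [hs, hm, gl_word hl1 (den_pos hl hβ.le (hβγ.le.trans hγ.le)).ne']
  have eγ : l / m ^ 2 * (-1 / (γ + s)) + l / m = l * γ / ((l - 1) * γ + 1) := by
    rw [hs, hm, gl_word hl1 (den_pos hl (hβ.le.trans hβγ.le) hγ.le).ne']
  rw [e0, e1, eβ, eγ]

include hT hD in
/-- **Affine normal form**: `G(a,b,c,y) = G(0, (b−a)/(y−a), (c−a)/(y−a), 1)`. [folklore] -/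
theorem normal_form (a b c y : ℝ) (hab : a < b) (hbc : b < c) (hcy : c < y) :
    G a b c y = G 0 ((b - a) / (y - a)) ((c - a) / (y - a)) 1 := by
  have hya : 0 < y - a := by linarith
  have h1 := hT a b c y (-a) hab hbc hcy
  have h2 := hD (a + -a) (b + -a) (c + -a) (y + -a) (1 / (y - a)) (by linarith) (by linarith)
    (by linarith) (by positivity)
  rw [← h1, ← h2]
  congr 1
  · ring
  · ring
  · ring
  · field_simp; ring

/-- The cross-ratio of the normal form `(0, β, γ, 1)`. [folklore] -/
theorem crossRatio_normal (β γ : ℝ) :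
    crossRatio ![0, β, γ, 1] = β * (1 - γ) / (γ * (1 - β)) := by
  rw [crossRatio_four]
  rcases eq_or_ne γ 0 with rfl | hγ
  · simp
  rcases eq_or_ne β 1 with rfl | hβ
  · simp
  have h1 : (0 - γ) * (β - 1) ≠ 0 := mul_ne_zero (by simpa using hγ) (sub_ne_zero.2 hβ)
  have h2 : γ * (1 - β) ≠ 0 := mul_ne_zero hγ (sub_ne_zero.2 (Ne.symm hβ))
  rw [div_eq_div_iff h1 h2]; ring

/-- The cross-ratio is affine invariant: it equals that of the normal form. [folklore] -/
theorem crossRatio_eq_normal {a b c y : ℝ} (hab : a < b) (hbc : b < c) (hcy : c < y) :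
    crossRatio ![a, b, c, y] = crossRatio ![0, (b - a) / (y - a), (c - a) / (y - a), 1] := by
  rw [crossRatio_normal, crossRatio_four]
  have hya : 0 < y - a := by linarith
  have e1 : 1 - (b - a) / (y - a) = (y - b) / (y - a) := by
    rw [eq_div_iff hya.ne', sub_mul, div_mul_cancel₀ _ hya.ne']; ring
  have e2 : 1 - (c - a) / (y - a) = (y - c) / (y - a) := by
    rw [eq_div_iff hya.ne', sub_mul, div_mul_cancel₀ _ hya.ne']; ring
  rw [e1, e2, div_mul_div_comm, div_mul_div_comm, div_div_div_cancel_right₀ (mul_pos hya hya).ne']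
  have h1 : (a - c) * (b - y) ≠ 0 := mul_ne_zero (by linarith) (by linarith)
  have h2 : (c - a) * (y - b) ≠ 0 := mul_ne_zero (by linarith) (by linarith)
  rw [div_eq_div_iff h1 h2]; ring

/-- `g_λ` preserves the normal-form cross-ratio. [folklore] -/
theorem crossRatio_normal_gl {β γ l : ℝ} (hβ : 0 < β) (hβγ : β < γ) (hγ : γ < 1) (hl : 0 < l) :
    crossRatio ![0, l * β / ((l - 1) * β + 1), l * γ / ((l - 1) * γ + 1), 1] =
      crossRatio ![0, β, γ, 1] := by
  have hb := den_pos hl hβ.le (hβγ.le.trans hγ.le)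
  have hc := den_pos hl (hβ.le.trans hβγ.le) hγ.le
  rw [crossRatio_normal, crossRatio_normal]
  have e1 : 1 - l * γ / ((l - 1) * γ + 1) = (1 - γ) / ((l - 1) * γ + 1) := by
    rw [eq_div_iff hc.ne', sub_mul, div_mul_cancel₀ _ hc.ne']; ring
  have e2 : 1 - l * β / ((l - 1) * β + 1) = (1 - β) / ((l - 1) * β + 1) := by
    rw [eq_div_iff hb.ne', sub_mul, div_mul_cancel₀ _ hb.ne']; ring
  rw [e1, e2, div_mul_div_comm, div_mul_div_comm, mul_comm ((l - 1) * γ + 1) ((l - 1) * β + 1),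
    div_div_div_cancel_right₀ (mul_pos hb hc).ne',
    show l * β * (1 - γ) = l * (β * (1 - γ)) by ring, show l * γ * (1 - β) = l * (γ * (1 - β)) by ring,
    mul_div_mul_left _ _ hl.ne']

/-- The normal-form cross-ratio determines `γ` given `β`. [folklore] -/
theorem gamma_eq_of_crossRatio_eq {β γ γ' : ℝ} (hβ0 : β ≠ 0) (hβ : β ≠ 1) (hγ : γ ≠ 0) (hγ' : γ' ≠ 0)
    (h : crossRatio ![0, β, γ, 1] = crossRatio ![0, β, γ', 1]) : γ = γ' := by
  rw [crossRatio_normal, crossRatio_normal, div_eq_div_iff (mul_ne_zero hγ (sub_ne_zero.2 (Ne.symm hβ)))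
    (mul_ne_zero hγ' (sub_ne_zero.2 (Ne.symm hβ)))] at h
  have h1 : β * (1 - β) * (γ' - γ) = 0 := by linear_combination h
  have h2 : β * (1 - β) ≠ 0 := mul_ne_zero hβ0 (sub_ne_zero.2 (Ne.symm hβ))
  have h3 := (mul_eq_zero.1 h1).resolve_left h2
  linarith

include hT hD hR hI in
/-- **Möbius covariance ⟹ function of the cross-ratio.**  A function of four ordered collinear marks
invariant under translations, dilations, reflection and inversion of positive quadruples takes the
same value on any two quadruples with the same cross-ratio. [folklore] -/
theorem eq_of_crossRatio_eq {a b c y a' b' c' y' : ℝ} (hab : a < b) (hbc : b < c) (hcy : c < y)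
    (hab' : a' < b') (hbc' : b' < c') (hcy' : c' < y')
    (h : crossRatio ![a, b, c, y] = crossRatio ![a', b', c', y']) :
    G a b c y = G a' b' c' y' := by
  rw [normal_form hT hD a b c y hab hbc hcy, normal_form hT hD a' b' c' y' hab' hbc' hcy']
  rw [crossRatio_eq_normal hab hbc hcy, crossRatio_eq_normal hab' hbc' hcy'] at h
  set β := (b - a) / (y - a) with hβd
  set γ := (c - a) / (y - a) with hγd
  set β' := (b' - a') / (y' - a') with hβd'
  set γ' := (c' - a') / (y' - a') with hγd'
  have hya : 0 < y - a := by linarith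
  have hya' : 0 < y' - a' := by linarith
  have hβ0 : 0 < β := by rw [hβd]; exact div_pos (by linarith) hya
  have hβγ : β < γ := by rw [hβd, hγd]; exact div_lt_div_of_pos_right (by linarith) hya
  have hγ1 : γ < 1 := by rw [hγd, div_lt_one hya]; linarith
  have hβ0' : 0 < β' := by rw [hβd']; exact div_pos (by linarith) hya'
  have hβγ' : β' < γ' := by rw [hβd', hγd']; exact div_lt_div_of_pos_right (by linarith) hya'
  have hγ1' : γ' < 1 := by rw [hγd', div_lt_one hya']; linarith
  -- the parameter moving β to β'
  have hk : β * (1 - β') ≠ 0 := (mul_pos hβ0 (by linarith)).ne'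
  set l := β' * (1 - β) / (β * (1 - β')) with hl
  have hl0 : 0 < l := by rw [hl]; exact div_pos (mul_pos hβ0' (by linarith)) (mul_pos hβ0 (by linarith))
  have hlk : l * (β * (1 - β')) = β' * (1 - β) := by rw [hl]; exact div_mul_cancel₀ _ hk
  have hd := den_pos hl0 hβ0.le (hβγ.le.trans hγ1.le)
  have hlβ : l * β / ((l - 1) * β + 1) = β' := by
    rw [div_eq_iff hd.ne']; linear_combination hlk
  have key := moebius01 hT hD hR hI hβ0 hβγ hγ1 hl0
  rw [hlβ] at key
  rw [key]
  congr 1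
  -- identify the image of γ through the cross-ratio
  have hcr := crossRatio_normal_gl hβ0 hβγ hγ1 hl0
  rw [hlβ, h] at hcr
  have hden := den_pos hl0 (hβ0.le.trans hβγ.le) hγ1.le
  exact (gamma_eq_of_crossRatio_eq hβ0'.ne' (hβγ'.trans hγ1').ne (hβ0'.trans hβγ').ne'
    (div_pos (mul_pos hl0 (hβ0.trans hβγ)) hden).ne' hcr.symm).symm

end Algebra

/-! ## §15 The crux as EXISTENCE + INVERSION COVARIANCE + PROFILE -/

/-- The cross-ratio is invariant under the inversion `x ↦ −1/x` of a positive quadruple. [folklore] -/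
theorem crossRatio_inv {a b c y : ℝ} (ha : 0 < a) (hab : a < b) (hbc : b < c) (hcy : c < y) :
    crossRatio ![-1 / a, -1 / b, -1 / c, -1 / y] = crossRatio ![a, b, c, y] := by
  rw [crossRatio_four, crossRatio_four]
  have hb : 0 < b := ha.trans hab
  have hc : 0 < c := hb.trans hbc
  have hy : 0 < y := hc.trans hcy
  have e1 : (-1 / a - -1 / b) * (-1 / c - -1 / y) = (a - b) * (c - y) / (a * b * (c * y)) := by
    field_simp; ring
  have e2 : (-1 / a - -1 / c) * (-1 / b - -1 / y) = (a - c) * (b - y) / (a * c * (b * y)) := by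
    field_simp; ring
  rw [e1, e2, show a * c * (b * y) = a * b * (c * y) by ring, div_div_div_cancel_right₀ (by positivity)]

/-- The normal family `(0, t, 1, 2)` has cross-ratio `t/(2−t)`. [folklore] -/
theorem crossRatio_family (t : ℝ) : crossRatio ![0, t, 1, 2] = t / (2 - t) := by
  rw [crossRatio_four]
  rcases eq_or_ne t 2 with rfl | ht
  · simp
  rw [div_eq_div_iff (mul_ne_zero (by norm_num) (sub_ne_zero.2 ht)) (sub_ne_zero.2 (Ne.symm ht))]
  ring

/-- Every cross-ratio in `(0,1)` is attained on the normal family: `t = 2η/(1+η)`. [folklore] -/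
theorem family_param {η : ℝ} (h0 : 0 < η) (h1 : η < 1) :
    0 < 2 * η / (1 + η) ∧ 2 * η / (1 + η) < 1 ∧ 2 * η / (1 + η) / (2 - 2 * η / (1 + η)) = η := by
  have hp : 0 < 1 + η := by linarith
  refine ⟨by positivity, by rw [div_lt_one hp]; linarith, ?_⟩
  have e : 2 - 2 * η / (1 + η) = 2 / (1 + η) := by
    rw [eq_div_iff hp.ne', sub_mul, div_mul_cancel₀ _ hp.ne']; ring
  rw [e, div_div_div_cancel_right₀ hp.ne']
  field_simp

/-- **C⁺ ⟺ existence of the full limit + inversion covariance + Cardy's profile on one normal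
family.**  The collinear half-plane Cardy law for bond-`ℤ²` holds iff `P_n` converges at every point
of the chamber to some `G` which is inversion covariant on positive quadruples
(`G(−1/a,−1/b,−1/c,−1/y) = G(a,b,c,y)`) and equals `F(t/(2−t))` along `(0, t, 1, 2)`, `0 < t < 1`.
(`⟸`: a full limit is translation, dilation and reflection invariant by `translate_of_jointLimit`,
`dilate_of_limit`, `reflect_of_jointLimit`; with inversion it is a function of the cross-ratio,
`eq_of_crossRatio_eq`; the normal family carries every cross-ratio, `family_param`.) [folklore] -/
theorem collinearCardy_iff_limit_inversion_profile :
    (∀ a b c y : ℝ, a < b → b < c → c < y →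
      Tendsto (fun n : ℕ ↦ μ.real (openCrossing halfPlane (arcA a b n) (rowIcc ⌊c * n⌋ ⌊y * n⌋))) atTop
        (𝓝 (Literature.Probability.RandomPlanarGeometry.cardyFunction (crossRatio ![a, b, c, y])))) ↔
    ∃ G : ℝ → ℝ → ℝ → ℝ → ℝ,
      (∀ a b c y : ℝ, a < b → b < c → c < y →
        Tendsto (fun n : ℕ ↦ μ.real (openCrossing halfPlane (arcA a b n) (rowIcc ⌊c * n⌋ ⌊y * n⌋)))
          atTop (𝓝 (G a b c y))) ∧
      (∀ a b c y : ℝ, 0 < a → a < b → b < c → c < y →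
        G (-1 / a) (-1 / b) (-1 / c) (-1 / y) = G a b c y) ∧
      (∀ t : ℝ, 0 < t → t < 1 → G 0 t 1 2 = Literature.Probability.RandomPlanarGeometry.cardyFunction (t / (2 - t))) := by
  constructor
  · intro hC
    refine ⟨fun a b c y ↦ Literature.Probability.RandomPlanarGeometry.cardyFunction (crossRatio ![a, b, c, y]), hC, fun a b c y ha hab hbc hcy ↦ ?_,
      fun t _ _ ↦ ?_⟩
    · simp only [crossRatio_inv ha hab hbc hcy]
    · simp only [crossRatio_family]
  · rintro ⟨G, hlim, hinv, hprof⟩ a b c y hab hbc hcy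
    have hlim' : ∀ a b c y : ℝ, a < b → b < c → c < y →
        Tendsto (fun n : ℕ ↦ μ.real (openCrossing halfPlane (arcA a b (id n))
          (rowIcc ⌊c * (id n : ℕ)⌋ ⌊y * (id n : ℕ)⌋))) atTop (𝓝 (G a b c y)) := hlim
    have hTr : ∀ a b c y t : ℝ, a < b → b < c → c < y →
        G (a + t) (b + t) (c + t) (y + t) = G a b c y :=
      fun a b c y t hab hbc hcy ↦ translate_of_jointLimit hlim' strictMono_id hab hbc hcy t
    have hDi : ∀ a b c y s : ℝ, a < b → b < c → c < y → 0 < s →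
        G (s * a) (s * b) (s * c) (s * y) = G a b c y :=
      fun a b c y s hab hbc hcy hs ↦ dilate_of_limit hlim hab hbc hcy hs
    have hRe : ∀ a b c y : ℝ, a < b → b < c → c < y → G (-y) (-c) (-b) (-a) = G a b c y :=
      fun a b c y hab hbc hcy ↦ reflect_of_jointLimit hlim' strictMono_id hab hbc hcy
    set η := crossRatio ![a, b, c, y] with hη
    have hη01 := crossRatio_four_mem_Ioo hab hbc hcy
    obtain ⟨ht0, ht1, htη⟩ := family_param hη01.1 hη01.2
    set t := 2 * η / (1 + η) with ht
    have hcr : crossRatio ![a, b, c, y] = crossRatio ![0, t, 1, 2] := by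
      rw [crossRatio_family, htη]
    have hG : G a b c y = Literature.Probability.RandomPlanarGeometry.cardyFunction η := by
      rw [eq_of_crossRatio_eq hTr hDi hRe hinv hab hbc hcy ht0 ht1 (by norm_num) hcr, hprof t ht0 ht1, htη]
    rw [← hG]
    exact hlim a b c y hab hbc hcy

/-- **The crux as EXISTENCE + INVERSION COVARIANCE + PROFILE** (`stub_equivalence` + the previous
theorem): `HalfPlaneMarkDensityLaw` holds iff the collinear half-plane crossing function of bond-`ℤ²`
converges on the chamber to a function that is inversion covariant on positive quadruples and has
Cardy's profile along the single normal family `(0,t,1,2)`.  The three conjuncts are the open inputs;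
everything else (translation, dilation, reflection invariance; continuity; monotonicity;
positivity; decay at `η = 0`) is a theorem of this line. [folklore] -/
theorem halfPlaneMarkDensityLaw_iff_limit_inversion_profile :
    HalfPlaneMarkDensityLaw ↔
    ∃ G : ℝ → ℝ → ℝ → ℝ → ℝ,
      (∀ a b c y : ℝ, a < b → b < c → c < y →
        Tendsto (fun n : ℕ ↦ μ.real (openCrossing halfPlane (arcA a b n) (rowIcc ⌊c * n⌋ ⌊y * n⌋)))
          atTop (𝓝 (G a b c y))) ∧
      (∀ a b c y : ℝ, 0 < a → a < b → b < c → c < y →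
        G (-1 / a) (-1 / b) (-1 / c) (-1 / y) = G a b c y) ∧
      (∀ t : ℝ, 0 < t → t < 1 → G 0 t 1 2 = Literature.Probability.RandomPlanarGeometry.cardyFunction (t / (2 - t))) :=
  stub_equivalence.trans collinearCardy_iff_limit_inversion_profile

end Subseq

/-- **Registered extra stub of line `Sketch` (lead c2-0): the Möbius reduction of the crux.**
`HalfPlaneMarkDensityLaw ⟺ ∃ G, (P_n → G on the chamber) ∧ (G inversion covariant on positive
quadruples) ∧ (G = F(t/(2−t)) along (0,t,1,2))`. [folklore] -/
theorem stub_moebiusReduction :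
    HalfPlaneMarkDensityLaw ↔
    ∃ G : ℝ → ℝ → ℝ → ℝ → ℝ,
      (∀ a b c y : ℝ, a < b → b < c → c < y →
        Tendsto (fun n : ℕ ↦ μ.real (openCrossing halfPlane (arcA a b n) (rowIcc ⌊c * n⌋ ⌊y * n⌋)))
          atTop (𝓝 (G a b c y))) ∧
      (∀ a b c y : ℝ, 0 < a → a < b → b < c → c < y →
        G (-1 / a) (-1 / b) (-1 / c) (-1 / y) = G a b c y) ∧
      (∀ t : ℝ, 0 < t → t < 1 → G 0 t 1 2 =
        Literature.Probability.RandomPlanarGeometry.cardyFunction (t / (2 - t))) :=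
  Subseq.halfPlaneMarkDensityLaw_iff_limit_inversion_profile

end Summit.CriticalPhenomena.CardyFormulaZ2.Cruxes.HalfPlaneMarkDensityLaw.SketchLine

end
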